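import Summits.Ventures.CertifiedManyBodySolver.Observables.SourcedGibbsTrialCapAFRows
import HarnessLib

/-!
# The AF–BCS sourced cap in the CANONICAL (fixed-density) CLASS of the thermodynamic limit from two certified grids

Cell hubbard-obs (seat hubbard-obs-pin-2). HONEST FRAMING: zero compute; implications only; the certified momentum sums
enter as HYPOTHESES (interval tables of the cell's engine `hfbcs_cap_afcanon.py`, kernel-form columns). The
antiferromagnetic analogue of `exists_canonicalClass_sourced_le_of_two_HFBCS_grids` (`SourcedGibbsTrialCapCanonical` §2):
TWO AF + `d`-wave-pinned BCS trial families `(μ'ᵢ, βᵢ, Mᵢ)` at the same field `h`, certified on ONE even grid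
`L₁ = 2k₁`, whose limit-density boxes `[2aᵢ − 2δᵢ, 2bᵢ + 2δᵢ]` bracket `n`, with the four corner conditions of the
mixing bridge (`qᵢ(d) = Cᵢ + μ'ᵢ d + U d²/4`, `Cᵢ = 2swᵢ + 2ε − Uσᵢ² − 2Mᵢσᵢ + Γᵢ`), give SOME translation-invariant
state of density EXACTLY `n` with sourced mean energy `e^{src}_h ≤ u` (`hubbardTTPrimeSourcedInteraction 1 0 U 0 d h`)
— the `hcap` slot of the canonical-class response-floor reader. (`U ≥ 0`, `βᵢ ≥ 0`, `μ'ᵢ ≠ 0`, `Mᵢ ≠ 0`.) A sourced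
variational CAP; not a statement about magnetic or superconducting order; not a superconductivity verdict.

References: Bach–Lieb–Solovej (1994) §2 [BachLiebSolovej1994]; Bratteli–Robinson I §4.3.1 [BratteliRobinsonI1987];
Davis–Rabinowitz (1984) §2.1 eq. (2.1.6) [DavisRabinowitz1984]; Hirsch PRB 31 (1985) 4403 [HirschPRB1985].
-/

noncomputable section

open Real Finset Matrix Literature.MathematicalPhysics.QuantumLattice Literature.Probability.LatticeModels
open Literature.MathematicalPhysics.QuantumLattice.HubbardWave0 Literature.MathematicalPhysics.QuantumLattice.ThermodynamicLimit

namespace Summit.Ventures.CertifiedManyBodySolver.Observables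

section AFAssembly

set_option maxHeartbeats 3000000 in -- long explicit statement (momentum sums); elaboration, no search
set_option maxRecDepth 8192 in
/-- **THE CANONICAL-CLASS AF–BCS CAP FROM TWO CERTIFIED GRIDS** (even grid `2k₁ ≥ 3`; see the module docstring).
[cite: BachLiebSolovej1994, §2] [cite: BratteliRobinsonI1987, §4.3.1] [cite: DavisRabinowitz1984, §2.1 eq. (2.1.6)] -/
theorem exists_canonicalClass_sourced_le_of_two_AFBCS_grids (k₁ : ℕ) [NeZero (2 * k₁)] (hk₁ : 3 ≤ 2 * k₁) {U : ℝ}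
    (hU : 0 ≤ U) (h μ'₁ M₁ μ'₂ M₂ : ℝ) {β₁ β₂ : ℝ} (hβ₁ : 0 ≤ β₁) (hβ₂ : 0 ≤ β₂) (hμ₁ : μ'₁ ≠ 0) (hM₁ : M₁ ≠ 0)
    (hμ₂ : μ'₂ ≠ 0) (hM₂ : M₂ ≠ 0)
    {sw₁ a₁ b₁ sq₁ tq₁ δ₁ σ₁ Γ₁ sw₂ a₂ b₂ sq₂ tq₂ δ₂ σ₂ Γ₂ ε n u : ℝ}
    (hsw₁ : (∑ p : TorusSite 2 (2 * k₁), ((torusBand (2 * k₁) p - μ'₁) * (1 / 2 - Real.tanh (β₁ * Real.sqrt ((Real.sqrt (torusBand (2 * k₁) p ^ 2 + M₁ ^ 2) + |μ'₁|) ^ 2 + (2 * Real.sqrt 2 * h * dWaveGap p) ^ 2) / 2) / (2 * Real.sqrt ((Real.sqrt (torusBand (2 * k₁) p ^ 2 + M₁ ^ 2) + |μ'₁|) ^ 2 + (2 * Real.sqrt 2 * h * dWaveGap p) ^ 2)) * ((torusBand (2 * k₁) p - μ'₁) / 2 - μ'₁ / (2 * |μ'₁| * Real.sqrt (torusBand (2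 * k₁) p ^ 2 + M₁ ^ 2)) * (torusBand (2 * k₁) p ^ 2 + M₁ ^ 2 - torusBand (2 * k₁) p * μ'₁)) - Real.tanh (β₁ * Real.sqrt ((Real.sqrt (torusBand (2 * k₁) p ^ 2 + M₁ ^ 2) - |μ'₁|) ^ 2 + (2 * Real.sqrt 2 * h * dWaveGap p) ^ 2) / 2) / (2 * Real.sqrt ((Real.sqrt (torusBand (2 * k₁) p ^ 2 + M₁ ^ 2) - |μ'₁|) ^ 2 + (2 * Real.sqrt 2 * h * dWaveGap p) ^ 2)) * ((torusBand (2 * k₁) p - μ'₁) / 2 + μ'₁ / (2 * |μ'₁| * Real.sqrt (torusBand (2 * k₁) p ^ 2 + M₁ ^ 2)) * (torusBand (2 * k₁) p ^ 2 + M₁ ^ 2 - torusBand (2 * k₁) p * μ'₁))) + (2 * Real.sqrt 2 * h * dWaveGap p) * (-(2 * Real.sqrt 2 * h * dWaveGap p) * (Real.tanh (β₁ * Real.sqrt ((Real.sqrt (torusBand (2 * k₁) p ^ 2 + M₁ ^ 2) + |μ'₁|) ^ 2 + (2 * Real.sqrt 2 * h * dWaveGap p) ^ 2) / 2) / (2 *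 Real.sqrt ((Real.sqrt (torusBand (2 * k₁) p ^ 2 + M₁ ^ 2) + |μ'₁|) ^ 2 + (2 * Real.sqrt 2 * h * dWaveGap p) ^ 2)) * (1 / 2 - μ'₁ / (2 * |μ'₁| * Real.sqrt (torusBand (2 * k₁) p ^ 2 + M₁ ^ 2)) * torusBand (2 * k₁) p) + Real.tanh (β₁ * Real.sqrt ((Real.sqrt (torusBand (2 * k₁) p ^ 2 + M₁ ^ 2) - |μ'₁|) ^ 2 + (2 * Real.sqrt 2 * h * dWaveGap p) ^ 2) / 2) / (2 * Real.sqrt ((Real.sqrt (torusBand (2 * k₁) p ^ 2 + M₁ ^ 2) - |μ'₁|) ^ 2 + (2 * Real.sqrt 2 * h * dWaveGap p) ^ 2)) * (1 / 2 + μ'₁ / (2 * |μ'₁| * Real.sqrt (torusBand (2 * k₁) p ^ 2 + M₁ ^ 2)) * torusBand (2 * k₁) p))) + M₁ * (-M₁ * (Real.tanh (β₁ * Real.sqrt ((Real.sqrt (torusBand (2 * k₁) p ^ 2 + M₁ ^ 2) + |μ'₁|) ^ 2 + (2 * Real.sqrt 2 * h * dWaveGap p) ^ 2) / 2) / (2 *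 Real.sqrt ((Real.sqrt (torusBand (2 * k₁) p ^ 2 + M₁ ^ 2) + |μ'₁|) ^ 2 + (2 * Real.sqrt 2 * h * dWaveGap p) ^ 2)) * (1 / 2 + μ'₁ / (2 * |μ'₁| * Real.sqrt (torusBand (2 * k₁) p ^ 2 + M₁ ^ 2)) * μ'₁) + Real.tanh (β₁ * Real.sqrt ((Real.sqrt (torusBand (2 * k₁) p ^ 2 + M₁ ^ 2) - |μ'₁|) ^ 2 + (2 * Real.sqrt 2 * h * dWaveGap p) ^ 2) / 2) / (2 * Real.sqrt ((Real.sqrt (torusBand (2 * k₁) p ^ 2 + M₁ ^ 2) - |μ'₁|) ^ 2 + (2 * Real.sqrt 2 * h * dWaveGap p) ^ 2)) * (1 / 2 - μ'₁ / (2 * |μ'₁| * Real.sqrt (torusBand (2 * k₁) p ^ 2 + M₁ ^ 2)) * μ'₁))))) / ((2 * k₁ : ℕ) : ℝ) ^ 2 ≤ sw₁)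
    (ha₁ : a₁ ≤ (∑ p : TorusSite 2 (2 * k₁), (1 / 2 - Real.tanh (β₁ * Real.sqrt ((Real.sqrt (torusBand (2 * k₁) p ^ 2 + M₁ ^ 2) + |μ'₁|) ^ 2 + (2 * Real.sqrt 2 * h * dWaveGap p) ^ 2) / 2) / (2 * Real.sqrt ((Real.sqrt (torusBand (2 * k₁) p ^ 2 + M₁ ^ 2) + |μ'₁|) ^ 2 + (2 * Real.sqrt 2 * h * dWaveGap p) ^ 2)) * ((torusBand (2 * k₁) p - μ'₁) / 2 - μ'₁ / (2 * |μ'₁| * Real.sqrt (torusBand (2 * k₁) p ^ 2 + M₁ ^ 2)) * (torusBand (2 * k₁) p ^ 2 + M₁ ^ 2 - torusBand (2 * k₁) p * μ'₁)) - Real.tanh (β₁ * Real.sqrt ((Real.sqrt (torusBand (2 * k₁) p ^ 2 + M₁ ^ 2) - |μ'₁|) ^ 2 + (2 * Real.sqrt 2 * h * dWaveGap p) ^ 2) / 2) / (2 * Real.sqrt ((Real.sqrt (torusBand (2 * k₁) p ^ 2 + M₁ ^ 2) - |μ'₁|) ^ 2 + (2 * Real.sqrt 2 * h * dWaveGap p)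 ^ 2)) * ((torusBand (2 * k₁) p - μ'₁) / 2 + μ'₁ / (2 * |μ'₁| * Real.sqrt (torusBand (2 * k₁) p ^ 2 + M₁ ^ 2)) * (torusBand (2 * k₁) p ^ 2 + M₁ ^ 2 - torusBand (2 * k₁) p * μ'₁)))) / ((2 * k₁ : ℕ) : ℝ) ^ 2)
    (hb₁ : (∑ p : TorusSite 2 (2 * k₁), (1 / 2 - Real.tanh (β₁ * Real.sqrt ((Real.sqrt (torusBand (2 * k₁) p ^ 2 + M₁ ^ 2) + |μ'₁|) ^ 2 + (2 * Real.sqrt 2 * h * dWaveGap p) ^ 2) / 2) / (2 * Real.sqrt ((Real.sqrt (torusBand (2 * k₁) p ^ 2 + M₁ ^ 2) + |μ'₁|) ^ 2 + (2 * Real.sqrt 2 * h * dWaveGap p) ^ 2)) * ((torusBand (2 * k₁) p - μ'₁) / 2 - μ'₁ / (2 * |μ'₁| * Real.sqrt (torusBand (2 * k₁) p ^ 2 + M₁ ^ 2)) * (torusBand (2 * k₁) p ^ 2 + M₁ ^ 2 - torusBand (2 * k₁) p * μ'₁)) - Real.tanh (β₁ * Real.sqrt ((Real.sqrt (torusBand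 (2 * k₁) p ^ 2 + M₁ ^ 2) - |μ'₁|) ^ 2 + (2 * Real.sqrt 2 * h * dWaveGap p) ^ 2) / 2) / (2 * Real.sqrt ((Real.sqrt (torusBand (2 * k₁) p ^ 2 + M₁ ^ 2) - |μ'₁|) ^ 2 + (2 * Real.sqrt 2 * h * dWaveGap p) ^ 2)) * ((torusBand (2 * k₁) p - μ'₁) / 2 + μ'₁ / (2 * |μ'₁| * Real.sqrt (torusBand (2 * k₁) p ^ 2 + M₁ ^ 2)) * (torusBand (2 * k₁) p ^ 2 + M₁ ^ 2 - torusBand (2 * k₁) p * μ'₁)))) / ((2 * k₁ : ℕ) : ℝ) ^ 2 ≤ b₁)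
    (hsq₁ : sq₁ ≤ (∑ p : TorusSite 2 (2 * k₁), (-M₁ * (Real.tanh (β₁ * Real.sqrt ((Real.sqrt (torusBand (2 * k₁) p ^ 2 + M₁ ^ 2) + |μ'₁|) ^ 2 + (2 * Real.sqrt 2 * h * dWaveGap p) ^ 2) / 2) / (2 * Real.sqrt ((Real.sqrt (torusBand (2 * k₁) p ^ 2 + M₁ ^ 2) + |μ'₁|) ^ 2 + (2 * Real.sqrt 2 * h * dWaveGap p) ^ 2)) * (1 / 2 + μ'₁ / (2 * |μ'₁| * Real.sqrt (torusBand (2 * k₁) p ^ 2 + M₁ ^ 2)) * μ'₁) + Real.tanh (β₁ * Real.sqrt ((Real.sqrt (torusBand (2 * k₁) p ^ 2 + M₁ ^ 2) - |μ'₁|) ^ 2 + (2 * Real.sqrt 2 * h * dWaveGap p) ^ 2) / 2) / (2 * Real.sqrt ((Real.sqrt (torusBand (2 * k₁) p ^ 2 + M₁ ^ 2) - |μ'₁|) ^ 2 + (2 * Real.sqrt 2 * h * dWaveGap p) ^ 2)) * (1 / 2 - μ'₁ / (2 * |μ'₁| * Real.sqrt (torusBand (2 * k₁) p ^ 2 +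 M₁ ^ 2)) * μ'₁)))) / ((2 * k₁ : ℕ) : ℝ) ^ 2)
    (htq₁ : (∑ p : TorusSite 2 (2 * k₁), (-M₁ * (Real.tanh (β₁ * Real.sqrt ((Real.sqrt (torusBand (2 * k₁) p ^ 2 + M₁ ^ 2) + |μ'₁|) ^ 2 + (2 * Real.sqrt 2 * h * dWaveGap p) ^ 2) / 2) / (2 * Real.sqrt ((Real.sqrt (torusBand (2 * k₁) p ^ 2 + M₁ ^ 2) + |μ'₁|) ^ 2 + (2 * Real.sqrt 2 * h * dWaveGap p) ^ 2)) * (1 / 2 + μ'₁ / (2 * |μ'₁| * Real.sqrt (torusBand (2 * k₁) p ^ 2 + M₁ ^ 2)) * μ'₁) + Real.tanh (β₁ * Real.sqrt ((Real.sqrt (torusBand (2 * k₁) p ^ 2 + M₁ ^ 2) - |μ'₁|) ^ 2 + (2 * Real.sqrt 2 * h * dWaveGap p) ^ 2) / 2) / (2 * Real.sqrt ((Real.sqrt (torusBand (2 * k₁) p ^ 2 + M₁ ^ 2) - |μ'₁|) ^ 2 + (2 * Real.sqrt 2 * h * dWaveGap p) ^ 2)) * (1 / 2 - μ'₁ / (2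 * |μ'₁| * Real.sqrt (torusBand (2 * k₁) p ^ 2 + M₁ ^ 2)) * μ'₁)))) / ((2 * k₁ : ℕ) : ℝ) ^ 2 ≤ tq₁)
    (hδ₁ : (2 * Real.pi * (β₁ / 4 * 2 * (2 + 2 * Real.sqrt 2 * |h|))) / ((2 * k₁ : ℕ) : ℝ) ≤ δ₁)
    (hΓ1₁ : (-2 * U * σ₁ - 2 * M₁) * (sq₁ - δ₁ - σ₁) ≤ Γ₁) (hΓ2₁ : (-2 * U * σ₁ - 2 * M₁) * (tq₁ + δ₁ - σ₁) ≤ Γ₁)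
    (hsw₂ : (∑ p : TorusSite 2 (2 * k₁), ((torusBand (2 * k₁) p - μ'₂) * (1 / 2 - Real.tanh (β₂ * Real.sqrt ((Real.sqrt (torusBand (2 * k₁) p ^ 2 + M₂ ^ 2) + |μ'₂|) ^ 2 + (2 * Real.sqrt 2 * h * dWaveGap p) ^ 2) / 2) / (2 * Real.sqrt ((Real.sqrt (torusBand (2 * k₁) p ^ 2 + M₂ ^ 2) + |μ'₂|) ^ 2 + (2 * Real.sqrt 2 * h * dWaveGap p) ^ 2)) * ((torusBand (2 * k₁) p - μ'₂) / 2 - μ'₂ / (2 * |μ'₂| * Real.sqrt (torusBand (2 * k₁) p ^ 2 + M₂ ^ 2)) * (torusBand (2 * k₁) p ^ 2 + M₂ ^ 2 - torusBand (2 * k₁) p * μ'₂)) - Real.tanh (β₂ * Real.sqrt ((Real.sqrt (torusBand (2 * k₁) p ^ 2 + M₂ ^ 2) - |μ'₂|) ^ 2 + (2 * Real.sqrt 2 * h * dWaveGap p) ^ 2) / 2) / (2 * Real.sqrt ((Real.sqrt (torusBand (2 * k₁) p ^ 2 + M₂ ^ 2) - |μ'₂|) ^ 2 + (2 * Real.sqrt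 2 * h * dWaveGap p) ^ 2)) * ((torusBand (2 * k₁) p - μ'₂) / 2 + μ'₂ / (2 * |μ'₂| * Real.sqrt (torusBand (2 * k₁) p ^ 2 + M₂ ^ 2)) * (torusBand (2 * k₁) p ^ 2 + M₂ ^ 2 - torusBand (2 * k₁) p * μ'₂))) + (2 * Real.sqrt 2 * h * dWaveGap p) * (-(2 * Real.sqrt 2 * h * dWaveGap p) * (Real.tanh (β₂ * Real.sqrt ((Real.sqrt (torusBand (2 * k₁) p ^ 2 + M₂ ^ 2) + |μ'₂|) ^ 2 + (2 * Real.sqrt 2 * h * dWaveGap p) ^ 2) / 2) / (2 * Real.sqrt ((Real.sqrt (torusBand (2 * k₁) p ^ 2 + M₂ ^ 2) + |μ'₂|) ^ 2 + (2 * Real.sqrt 2 * h * dWaveGap p) ^ 2)) * (1 / 2 - μ'₂ / (2 * |μ'₂| * Real.sqrt (torusBand (2 * k₁) p ^ 2 + M₂ ^ 2)) * torusBand (2 * k₁) p) + Real.tanh (β₂ * Real.sqrt ((Real.sqrt (torusBand (2 * k₁) p ^ 2 + M₂ ^ 2) - |μ'₂|) ^ 2 + (2 * Real.sqrt 2 *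 h * dWaveGap p) ^ 2) / 2) / (2 * Real.sqrt ((Real.sqrt (torusBand (2 * k₁) p ^ 2 + M₂ ^ 2) - |μ'₂|) ^ 2 + (2 * Real.sqrt 2 * h * dWaveGap p) ^ 2)) * (1 / 2 + μ'₂ / (2 * |μ'₂| * Real.sqrt (torusBand (2 * k₁) p ^ 2 + M₂ ^ 2)) * torusBand (2 * k₁) p))) + M₂ * (-M₂ * (Real.tanh (β₂ * Real.sqrt ((Real.sqrt (torusBand (2 * k₁) p ^ 2 + M₂ ^ 2) + |μ'₂|) ^ 2 + (2 * Real.sqrt 2 * h * dWaveGap p) ^ 2) / 2) / (2 * Real.sqrt ((Real.sqrt (torusBand (2 * k₁) p ^ 2 + M₂ ^ 2) + |μ'₂|) ^ 2 + (2 * Real.sqrt 2 * h * dWaveGap p) ^ 2)) * (1 / 2 + μ'₂ / (2 * |μ'₂| * Real.sqrt (torusBand (2 * k₁) p ^ 2 + M₂ ^ 2)) * μ'₂) + Real.tanh (β₂ * Real.sqrt ((Real.sqrt (torusBand (2 * k₁) p ^ 2 + M₂ ^ 2) - |μ'₂|) ^ 2 + (2 * Real.sqrt 2 * h * dWaveGap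 p) ^ 2) / 2) / (2 * Real.sqrt ((Real.sqrt (torusBand (2 * k₁) p ^ 2 + M₂ ^ 2) - |μ'₂|) ^ 2 + (2 * Real.sqrt 2 * h * dWaveGap p) ^ 2)) * (1 / 2 - μ'₂ / (2 * |μ'₂| * Real.sqrt (torusBand (2 * k₁) p ^ 2 + M₂ ^ 2)) * μ'₂))))) / ((2 * k₁ : ℕ) : ℝ) ^ 2 ≤ sw₂)
    (ha₂ : a₂ ≤ (∑ p : TorusSite 2 (2 * k₁), (1 / 2 - Real.tanh (β₂ * Real.sqrt ((Real.sqrt (torusBand (2 * k₁) p ^ 2 + M₂ ^ 2) + |μ'₂|) ^ 2 + (2 * Real.sqrt 2 * h * dWaveGap p) ^ 2) / 2) / (2 * Real.sqrt ((Real.sqrt (torusBand (2 * k₁) p ^ 2 + M₂ ^ 2) + |μ'₂|) ^ 2 + (2 * Real.sqrt 2 * h * dWaveGap p) ^ 2)) * ((torusBand (2 * k₁) p - μ'₂) / 2 - μ'₂ / (2 * |μ'₂| * Real.sqrt (torusBand (2 * k₁) p ^ 2 + M₂ ^ 2)) * (torusBand (2 * k₁) p ^ 2 + M₂ ^ 2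 - torusBand (2 * k₁) p * μ'₂)) - Real.tanh (β₂ * Real.sqrt ((Real.sqrt (torusBand (2 * k₁) p ^ 2 + M₂ ^ 2) - |μ'₂|) ^ 2 + (2 * Real.sqrt 2 * h * dWaveGap p) ^ 2) / 2) / (2 * Real.sqrt ((Real.sqrt (torusBand (2 * k₁) p ^ 2 + M₂ ^ 2) - |μ'₂|) ^ 2 + (2 * Real.sqrt 2 * h * dWaveGap p) ^ 2)) * ((torusBand (2 * k₁) p - μ'₂) / 2 + μ'₂ / (2 * |μ'₂| * Real.sqrt (torusBand (2 * k₁) p ^ 2 + M₂ ^ 2)) * (torusBand (2 * k₁) p ^ 2 + M₂ ^ 2 - torusBand (2 * k₁) p * μ'₂)))) / ((2 * k₁ : ℕ) : ℝ) ^ 2)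
    (hb₂ : (∑ p : TorusSite 2 (2 * k₁), (1 / 2 - Real.tanh (β₂ * Real.sqrt ((Real.sqrt (torusBand (2 * k₁) p ^ 2 + M₂ ^ 2) + |μ'₂|) ^ 2 + (2 * Real.sqrt 2 * h * dWaveGap p) ^ 2) / 2) / (2 * Real.sqrt ((Real.sqrt (torusBand (2 * k₁) p ^ 2 + M₂ ^ 2) + |μ'₂|) ^ 2 + (2 * Real.sqrt 2 * h * dWaveGap p) ^ 2)) * ((torusBand (2 * k₁) p - μ'₂) / 2 - μ'₂ / (2 * |μ'₂| * Real.sqrt (torusBand (2 * k₁) p ^ 2 + M₂ ^ 2)) * (torusBand (2 * k₁) p ^ 2 + M₂ ^ 2 - torusBand (2 * k₁) p * μ'₂)) - Real.tanh (β₂ * Real.sqrt ((Real.sqrt (torusBand (2 * k₁) p ^ 2 + M₂ ^ 2) - |μ'₂|) ^ 2 + (2 * Real.sqrt 2 * h * dWaveGap p) ^ 2) / 2) / (2 * Real.sqrt ((Real.sqrt (torusBand (2 * k₁) p ^ 2 + M₂ ^ 2) - |μ'₂|) ^ 2 + (2 * Real.sqrt 2 * h * dWaveGap p) ^ 2)) *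 ((torusBand (2 * k₁) p - μ'₂) / 2 + μ'₂ / (2 * |μ'₂| * Real.sqrt (torusBand (2 * k₁) p ^ 2 + M₂ ^ 2)) * (torusBand (2 * k₁) p ^ 2 + M₂ ^ 2 - torusBand (2 * k₁) p * μ'₂)))) / ((2 * k₁ : ℕ) : ℝ) ^ 2 ≤ b₂)
    (hsq₂ : sq₂ ≤ (∑ p : TorusSite 2 (2 * k₁), (-M₂ * (Real.tanh (β₂ * Real.sqrt ((Real.sqrt (torusBand (2 * k₁) p ^ 2 + M₂ ^ 2) + |μ'₂|) ^ 2 + (2 * Real.sqrt 2 * h * dWaveGap p) ^ 2) / 2) / (2 * Real.sqrt ((Real.sqrt (torusBand (2 * k₁) p ^ 2 + M₂ ^ 2) + |μ'₂|) ^ 2 + (2 * Real.sqrt 2 * h * dWaveGap p) ^ 2)) * (1 / 2 + μ'₂ / (2 * |μ'₂| * Real.sqrt (torusBand (2 * k₁) p ^ 2 + M₂ ^ 2)) * μ'₂) + Real.tanh (β₂ * Real.sqrt ((Real.sqrt (torusBand (2 * k₁) p ^ 2 + M₂ ^ 2) - |μ'₂|) ^ 2 + (2 * Real.sqrt 2 *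 h * dWaveGap p) ^ 2) / 2) / (2 * Real.sqrt ((Real.sqrt (torusBand (2 * k₁) p ^ 2 + M₂ ^ 2) - |μ'₂|) ^ 2 + (2 * Real.sqrt 2 * h * dWaveGap p) ^ 2)) * (1 / 2 - μ'₂ / (2 * |μ'₂| * Real.sqrt (torusBand (2 * k₁) p ^ 2 + M₂ ^ 2)) * μ'₂)))) / ((2 * k₁ : ℕ) : ℝ) ^ 2)
    (htq₂ : (∑ p : TorusSite 2 (2 * k₁), (-M₂ * (Real.tanh (β₂ * Real.sqrt ((Real.sqrt (torusBand (2 * k₁) p ^ 2 + M₂ ^ 2) + |μ'₂|) ^ 2 + (2 * Real.sqrt 2 * h * dWaveGap p) ^ 2) / 2) / (2 * Real.sqrt ((Real.sqrt (torusBand (2 * k₁) p ^ 2 + M₂ ^ 2) + |μ'₂|) ^ 2 + (2 * Real.sqrt 2 * h * dWaveGap p) ^ 2)) * (1 / 2 + μ'₂ / (2 * |μ'₂| * Real.sqrt (torusBand (2 * k₁) p ^ 2 + M₂ ^ 2)) * μ'₂) + Real.tanh (β₂ * Real.sqrt ((Real.sqrt (torusBand (2 * k₁) p ^ 2 + M₂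 ^ 2) - |μ'₂|) ^ 2 + (2 * Real.sqrt 2 * h * dWaveGap p) ^ 2) / 2) / (2 * Real.sqrt ((Real.sqrt (torusBand (2 * k₁) p ^ 2 + M₂ ^ 2) - |μ'₂|) ^ 2 + (2 * Real.sqrt 2 * h * dWaveGap p) ^ 2)) * (1 / 2 - μ'₂ / (2 * |μ'₂| * Real.sqrt (torusBand (2 * k₁) p ^ 2 + M₂ ^ 2)) * μ'₂)))) / ((2 * k₁ : ℕ) : ℝ) ^ 2 ≤ tq₂)
    (hδ₂ : (2 * Real.pi * (β₂ / 4 * 2 * (2 + 2 * Real.sqrt 2 * |h|))) / ((2 * k₁ : ℕ) : ℝ) ≤ δ₂)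
    (hΓ1₂ : (-2 * U * σ₂ - 2 * M₂) * (sq₂ - δ₂ - σ₂) ≤ Γ₂) (hΓ2₂ : (-2 * U * σ₂ - 2 * M₂) * (tq₂ + δ₂ - σ₂) ≤ Γ₂)
    (hε : (2 * Real.pi * (5 / 4 * 2 * (2 + 2 * Real.sqrt 2 * |h|))) / ((2 * k₁ : ℕ) : ℝ) ≤ ε)
    (hlt : (2 * b₁ + 2 * δ₁) < n) (hgt : n < (2 * a₂ - 2 * δ₂))
    (hcaa : ((2 * a₂ - 2 * δ₂) - n) * ((2 * sw₁ + 2 * ε + (-U * σ₁ ^ 2 - 2 * M₁ * σ₁) + Γ₁) + μ'₁ * (2 * a₁ - 2 * δ₁) + U * (2 * a₁ - 2 * δ₁) ^ 2 / 4) + (n - (2 * a₁ - 2 * δ₁)) * ((2 * sw₂ + 2 * ε + (-U * σ₂ ^ 2 - 2 * M₂ * σ₂) + Γ₂) + μ'₂ * (2 * a₂ - 2 * δ₂) + U * (2 * a₂ - 2 * δ₂) ^ 2 / 4) ≤ u * ((2 * a₂ - 2 * δ₂) - (2 * a₁ - 2 * δ₁)))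
    (hcab : ((2 * b₂ + 2 * δ₂) - n) * ((2 * sw₁ + 2 * ε + (-U * σ₁ ^ 2 - 2 * M₁ * σ₁) + Γ₁) + μ'₁ * (2 * a₁ - 2 * δ₁) + U * (2 * a₁ - 2 * δ₁) ^ 2 / 4) + (n - (2 * a₁ - 2 * δ₁)) * ((2 * sw₂ + 2 * ε + (-U * σ₂ ^ 2 - 2 * M₂ * σ₂) + Γ₂) + μ'₂ * (2 * b₂ + 2 * δ₂) + U * (2 * b₂ + 2 * δ₂) ^ 2 / 4) ≤ u * ((2 * b₂ + 2 * δ₂) - (2 * a₁ - 2 * δ₁)))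
    (hcba : ((2 * a₂ - 2 * δ₂) - n) * ((2 * sw₁ + 2 * ε + (-U * σ₁ ^ 2 - 2 * M₁ * σ₁) + Γ₁) + μ'₁ * (2 * b₁ + 2 * δ₁) + U * (2 * b₁ + 2 * δ₁) ^ 2 / 4) + (n - (2 * b₁ + 2 * δ₁)) * ((2 * sw₂ + 2 * ε + (-U * σ₂ ^ 2 - 2 * M₂ * σ₂) + Γ₂) + μ'₂ * (2 * a₂ - 2 * δ₂) + U * (2 * a₂ - 2 * δ₂) ^ 2 / 4) ≤ u * ((2 * a₂ - 2 * δ₂) - (2 * b₁ + 2 * δ₁)))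
    (hcbb : ((2 * b₂ + 2 * δ₂) - n) * ((2 * sw₁ + 2 * ε + (-U * σ₁ ^ 2 - 2 * M₁ * σ₁) + Γ₁) + μ'₁ * (2 * b₁ + 2 * δ₁) + U * (2 * b₁ + 2 * δ₁) ^ 2 / 4) + (n - (2 * b₁ + 2 * δ₁)) * ((2 * sw₂ + 2 * ε + (-U * σ₂ ^ 2 - 2 * M₂ * σ₂) + Γ₂) + μ'₂ * (2 * b₂ + 2 * δ₂) + U * (2 * b₂ + 2 * δ₂) ^ 2 / 4) ≤ u * ((2 * b₂ + 2 * δ₂) - (2 * b₁ + 2 * δ₁))) :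
    ∃ σ : InfVolFermionState 2, σ.IsTranslationInvariant ∧ σ.density = n ∧
      σ.meanEnergy (hubbardTTPrimeSourcedInteraction 1 0 U 0 dWaveFormFactor h) 1 ≤ u :=
  exists_isTranslationInvariant_density_eq_meanEnergy_sourced_le_of_two_gibbs_families_even 0 U 0 h β₁ β₂
    (2 * k₁) (2 * k₁) hU
    (afbcs_gibbs_rows_of_grid k₁ hk₁ hU μ'₁ h M₁ hβ₁ hμ₁ hM₁ hsw₁ ha₁ hb₁ hsq₁ htq₁ hδ₁ hε hΓ1₁ hΓ2₁)
    (afbcs_gibbs_rows_of_grid k₁ hk₁ hU μ'₂ h M₂ hβ₂ hμ₂ hM₂ hsw₂ ha₂ hb₂ hsq₂ htq₂ hδ₂ hε hΓ1₂ hΓ2₂)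
    hlt hgt hcaa hcab hcba hcbb

end AFAssembly

end Summit.Ventures.CertifiedManyBodySolver.Observables
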